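import Literature.Computability.FineGrained.SchoeningCoinMachine
import Literature.Computability.FineGrained.SchoeningCoinBound
import HarnessLib

/-!
# Fine-grained complexity — proofs: Schöning's theorem (`schoening_holds`, fine-grained.S21)

Topic `Literature/Computability/FineGrained`; sibling proof file of `SatAlgorithms.lean`
discharging its named fact

* `Literature.Computability.FineGrained.schoening` (**fine-grained.S21**; Schöning, FOCS 1999,
  Theorem: for every `k ≥ 3`, `k`-SAT ∈ BPTIME(`(2 - 2/k)^n · poly(L)`), stated as
  `∀ k ≥ 3, KSATInBPExpTime k (log₂ (2 - 2/k))`) as `schoening_holds`,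

by assembling the line `SchoeningCoin*`: the coin-string algorithm `run` and its one-sided error
(`SchoeningCoinAlgorithm.lean`), its success probability `uniformProb_run_ge`
(`SchoeningCoinBound.lean`: `≥ 2/3` once `R ≥ 2/σ` complete restarts fit into the coins,
`σ = kⁿ' / ((2^d n' + 1)(k n' + 1)(k-1)^(n'+k-3) 2ⁿ')`, `n'` the number of occurring variables),
and the machine `exists_machine` (`SchoeningCoinMachine.lean`: one `TM2` machine over `Bool` per
`k` computing `run φ (dOf k) (sOf φ) r` from `⟨encodeBool φ, r⟩` within `machineTime`). What is
proved here is arithmetic: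

* size bookkeeping (`length_formW_le`, `length_occs_le`, `nv_le_numVars`, `nv_le_length`): with
  `L = |encodeBool φ|`, the formula word, the header, the number of occurrences and of occurring
  variables are `≤ L + 1`, `≤ L`, `≤ numVars`;
* the coin budget `mFun k n L = R(n, L) · (cprMax + 1)` with
  `R(n, L) = 2 (2^d (L+1) + 1)(k (L+1) + 1)(k-1)^(k-3) · ((2k-2)^t / k^t + 1)`, `t = min n L`,
  which dominates `2/σ` (`hR_of`, through `pow_le_div_add_one_mul_pow`:
  `(2k-2)^n' ≤ ((2k-2)^t/k^t + 1) k^n'` for `n' ≤ t`) and accommodates `R` complete restarts;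
* the time bound `TFun k n L = 281 · Y⁵ · (mFun + 1)`, `Y = (2^d + 4k + 60)(L + 2)`, which
  dominates `machineTime` (a chain of crude polynomial bounds `scanCost ≤ 124 Y⁴`, …,
  `machineTime ≤ 281 Y⁵ (|r| + 1)`) and is `O(2^{δ n} · poly(L))` for `δ = log₂ (2 - 2/k)`
  (`isExpPolyBound_TFun`: `(2k-2)^t / k^t ≤ (2 - 2/k)^t ≤ (2 - 2/k)^n = 2^{δ n}`).

## References

* U. Schöning, *A probabilistic algorithm for k-SAT and constraint satisfaction problems*, Proc.
  40th FOCS (1999) 410–414, Theorem (`k`-SAT decided with one-sided error in time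
  `(2 - 2/k)^n · poly`) [key `SchoeningFOCS1999`; paywalled, acquisition requested 2026-08-15;
  statement and proof read in the two textbooks below].
* U. Schöning, J. Torán, *The Satisfiability Problem: Algorithms and Analyses*, Lehmanns 2013,
  §5.4, Theorem ("a probabilistic algorithm for k-SAT with running time `O*((2(1 - 1/k))^n)`")
  [key `SchoeningToran2013`; read 2026-08-15].
* J. Hromkovič, *Algorithmics for Hard Problems*, Springer 2001, §5.3.7, Theorem 5.3.7.2 and
  Exercise 5.3.7.3 [key `Hromkovic2001`; held, read 2026-08-15, pp. 417–420].
* R. Impagliazzo, R. Paturi, *On the complexity of k-SAT*, JCSS 62 (2001), §1 (the exponents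
  `2^{δ n} · poly(L)`, randomized algorithms).
-/

namespace Literature.Computability.FineGrained.SchoeningCoin

open _root_.Computability Complexity Turing BruteForce

variable {k : ℕ}

/-! ### Size bookkeeping -/

/-- The `Γ'`-encoding is the header, a comma, and the formula word. [folklore] -/
theorem length_encode_eq (φ : KCNF k) :
    φ.encode.length = (encodeNat φ.numVars).length + 1 + (formW φ).length := by
  have hlit : ∀ l : ℕ × Bool, (KCNF.encodeLiteral l).length = (litW l).length := fun l => by
    simp [KCNF.encodeLiteral, litW]
  have hc : ∀ c : List (ℕ × Bool), (c.flatMap KCNF.encodeLiteral).length = (c.flatMap litW).length := by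
    intro c
    induction c with
    | nil => rfl
    | cons l c ih => rw [List.flatMap_cons, List.flatMap_cons, List.length_append, List.length_append, hlit, ih]
  have hf : ∀ cs : List (List (ℕ × Bool)), (cs.flatMap KCNF.encodeClause).length = (cs.flatMap clauseW).length := by
    intro cs
    induction cs with
    | nil => rfl
    | cons c cs ih =>
      rw [List.flatMap_cons, List.flatMap_cons, List.length_append, List.length_append, ih]
      simp only [KCNF.encodeClause, clauseW, List.length_cons, List.length_append, hc]
      omega
  simp only [KCNF.encode, List.length_append, List.length_map, List.length_cons, formW, ← hf φ.clauses]
  omega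

/-- `|KCNF.encode φ| ≤ L + 1`. [folklore] -/
theorem length_encode_le (φ : KCNF k) : φ.encode.length ≤ φ.encodeBool.length + 1 := by
  have := two_mul_length_encode_le φ []
  rw [length_boolPair] at this
  simp only [List.length_nil, Nat.add_zero] at this
  omega

/-- The formula word is at most `L + 1` long. [folklore] -/
theorem length_formW_le (φ : KCNF k) : (formW φ).length ≤ φ.encodeBool.length + 1 := by
  have := length_encode_le φ; rw [length_encode_eq] at this; omega

/-- The header is at most `L` long. [folklore] -/
theorem length_header_le (φ : KCNF k) : (encodeNat φ.numVars).length ≤ φ.encodeBool.length := by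
  have := length_encode_le φ; rw [length_encode_eq] at this; omega

/-- Twice the number of occurrences is at most the length of the formula word. [folklore] -/
theorem two_mul_length_occs_le (φ : KCNF k) : 2 * (occs φ).length ≤ (formW φ).length := by
  unfold occs formW
  induction φ.clauses with
  | nil => simp
  | cons c cs ih =>
    rw [List.flatMap_cons, List.flatMap_cons, List.length_append, List.length_append, List.length_map]
    have : 2 * c.length ≤ (clauseW c).length := by
      simp only [clauseW, List.length_cons, List.length_append, List.length_flatMap]
      have : ∀ l : ℕ × Bool, 2 ≤ (litW l).length := fun l => by simp [litW]
      have hs := List.sum_le_sum (l := c) (f := fun _ => 2) (g := fun l => (litW l).length) (fun l _ => this l)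
      simp only [List.map_const', List.sum_replicate, smul_eq_mul] at hs
      omega
    omega

/-- The number of occurrences is at most `L`. [folklore] -/
theorem length_occs_le (φ : KCNF k) : (occs φ).length ≤ φ.encodeBool.length := by
  have := two_mul_length_occs_le φ; have := length_formW_le φ; omega

/-- The number of occurring variables is at most `numVars`. (Here `nv = SchoeningCoin.nv φ = |(occs φ).toFinset|`
of `SchoeningCoinBound.lean`; the homonymous `BruteForce.nv_le_numVars` of `SATBruteForceMachine.lean`
is about a different quantity, `BruteForce.nv φ = |pivs φ|`, so it cannot be reused.) [folklore] -/
theorem nv_le_numVars (φ : KCNF k) : nv φ ≤ φ.numVars := by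
  unfold nv vars
  calc (occs φ).toFinset.card ≤ (Finset.range φ.numVars).card := Finset.card_le_card fun x hx => by
        rw [List.mem_toFinset] at hx
        obtain ⟨c, hc, hx⟩ := List.mem_flatMap.1 hx
        obtain ⟨l, hl, rfl⟩ := List.mem_map.1 hx
        exact Finset.mem_range.2 (φ.fst_lt_numVars c hc l hl)
    _ = φ.numVars := Finset.card_range _

/-- The number of occurring variables is at most `L`. [folklore] -/
theorem nv_le_length (φ : KCNF k) : nv φ ≤ φ.encodeBool.length :=
  (List.toFinset_card_le _).trans (length_occs_le φ)

/-! ### The coin budget and the restart count -/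

/-- `(A^t / B^t + 1) · B^n' ≥ A^n'` for `B ≤ A`, `1 ≤ B`, `n' ≤ t`. [folklore] -/
theorem pow_le_div_add_one_mul_pow (A B t n' : ℕ) (hBA : B ≤ A) (hB : 1 ≤ B) (hn : n' ≤ t) :
    A ^ n' ≤ (A ^ t / B ^ t + 1) * B ^ n' := by
  have hBt : 0 < B ^ (t - n') := Nat.pow_pos hB
  have h1 := Nat.lt_div_mul_add (a := A ^ t) (Nat.pow_pos (n := t) hB)
  have h2 : A ^ n' * B ^ (t - n') ≤ A ^ t := by
    calc A ^ n' * B ^ (t - n') ≤ A ^ n' * A ^ (t - n') := Nat.mul_le_mul_left _ (Nat.pow_le_pow_left hBA _)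
      _ = A ^ t := by rw [← pow_add]; congr 1; omega
  have h3 : A ^ n' * B ^ (t - n') < (A ^ t / B ^ t + 1) * B ^ n' * B ^ (t - n') := by
    calc A ^ n' * B ^ (t - n') ≤ A ^ t := h2
      _ < A ^ t / B ^ t * B ^ t + B ^ t := h1
      _ = (A ^ t / B ^ t + 1) * B ^ n' * B ^ (t - n') := by
        rw [mul_assoc, ← pow_add, show n' + (t - n') = t by omega]; ring
  exact (Nat.lt_of_mul_lt_mul_right h3).le

/-- The restart count `R(n, L)`. [folklore] -/
def RFun (k n L : ℕ) : ℕ :=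
  2 * ((2 ^ dOf k * (L + 1) + 1) * (k * (L + 1) + 1) * (k - 1) ^ (k - 3)) *
    ((2 * k - 2) ^ min n L / k ^ min n L + 1)

/-- An upper bound on the coins of one complete restart, uniform in `L`. [folklore] -/
def cprMax (k L : ℕ) : ℕ := (L + 1) + (2 * k * (L + 1) + 1) * dOf k

/-- The coin budget `m(n, L)`: `R(n, L)` complete rounds. [folklore] -/
def mFun (k n L : ℕ) : ℕ := RFun k n L * (cprMax k L + 1)

/-- `cpr φ ≤ cprMax`. [folklore] -/
theorem cpr_le (φ : KCNF k) : cpr φ ≤ cprMax k φ.encodeBool.length := by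
  unfold cpr cprMax sOf
  have := length_occs_le φ
  have h1 : 2 * k * (occs φ).length + 1 ≤ 2 * k * (φ.encodeBool.length + 1) + 1 := by
    have := Nat.mul_le_mul_left (2 * k) this; nlinarith
  have := Nat.mul_le_mul_right (dOf k) h1
  omega

/-- **The restart count dominates `2/σ`**: the hypothesis `hR` of `uniformProb_run_ge`. [folklore] -/
theorem hR_of (hk : 3 ≤ k) (φ : KCNF k) :
    2 * ((2 ^ dOf k * nv φ + 1) * (k * nv φ + 1) * (k - 1) ^ (nv φ + (k - 3)) * 2 ^ nv φ) ≤
      RFun k φ.numVars φ.encodeBool.length * k ^ nv φ := by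
  set n' := nv φ
  set L := φ.encodeBool.length
  set t := min φ.numVars L with ht
  have hn't : n' ≤ t := le_min (nv_le_numVars φ) (nv_le_length φ)
  have hn'L : n' ≤ L := nv_le_length φ
  have key := pow_le_div_add_one_mul_pow (2 * k - 2) k t n' (by omega) (by omega) hn't
  have hpow : (k - 1) ^ (n' + (k - 3)) * 2 ^ n' = (2 * k - 2) ^ n' * (k - 1) ^ (k - 3) := by
    rw [pow_add, show 2 * k - 2 = (k - 1) * 2 by omega, mul_pow]; ring
  unfold RFun
  rw [← ht]
  have h1 : 2 ^ dOf k * n' + 1 ≤ 2 ^ dOf k * (L + 1) + 1 := by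
    have := Nat.mul_le_mul_left (2 ^ dOf k) (show n' ≤ L + 1 by omega); omega
  have h2 : k * n' + 1 ≤ k * (L + 1) + 1 := by
    have := Nat.mul_le_mul_left k (show n' ≤ L + 1 by omega); omega
  calc 2 * ((2 ^ dOf k * n' + 1) * (k * n' + 1) * (k - 1) ^ (n' + (k - 3)) * 2 ^ n')
      = 2 * ((2 ^ dOf k * n' + 1) * (k * n' + 1) * (k - 1) ^ (k - 3)) * (2 * k - 2) ^ n' := by
        rw [mul_assoc ((2 ^ dOf k * n' + 1) * (k * n' + 1)), hpow]; ring
    _ ≤ 2 * ((2 ^ dOf k * (L + 1) + 1) * (k * (L + 1) + 1) * (k - 1) ^ (k - 3)) *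
        (((2 * k - 2) ^ t / k ^ t + 1) * k ^ n') := by gcongr
    _ = _ := by ring

/-! ### The time bound -/

/-- The constant of the size scale. [folklore] -/
def cK (k : ℕ) : ℕ := 2 ^ dOf k + 4 * k + 60

/-- The size scale `Y = cK · (L + 2)`: every quantity of the machine is at most `Y` or `Y²`.
[folklore] -/
def Yb (k L : ℕ) : ℕ := cK k * (L + 2)

/-- The time bound `T(n, L) = 281 · Y⁵ · (m(n, L) + 1)`. [folklore] -/
def TFun (k n L : ℕ) : ℕ := 281 * Yb k L ^ 5 * (mFun k n L + 1)

/-- `scanCost` is monotone. [folklore] -/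
theorem scanCost_mono₂ {W W' V V' : ℕ} (hW : W ≤ W') (hV : V ≤ V') : scanCost W V ≤ scanCost W' V' := by
  unfold scanCost; gcongr

/-- `scanCost Y Y² ≤ 124 Y⁴`. [folklore] -/
theorem scanCost_le (Y : ℕ) (hY : 1 ≤ Y) : scanCost Y (Y ^ 2) ≤ 124 * Y ^ 4 := by
  unfold scanCost
  have h1 : Y ≤ Y ^ 4 := le_self_pow₀ hY (by norm_num)
  have h2 : Y ^ 2 ≤ Y ^ 4 := Nat.pow_le_pow_right hY (by norm_num)
  have h3 : Y ^ 3 ≤ Y ^ 4 := Nat.pow_le_pow_right hY (by norm_num)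
  have h4 : 1 ≤ Y ^ 4 := Nat.one_le_pow _ _ hY
  nlinarith [h1, h2, h3, h4]

/-- `stepCost ≤ 172 Y⁴`. [folklore] -/
theorem stepCost_le {Y W V : ℕ} (hY : 1 ≤ Y) (hk : k ≤ Y) (hd : dOf k ≤ Y) (hW : W ≤ Y) (hV : V ≤ Y ^ 2) :
    stepCost k W V ≤ 172 * Y ^ 4 := by
  unfold stepCost
  have hs := (scanCost_mono₂ hW hV).trans (scanCost_le Y hY)
  have h1 : Y ≤ Y ^ 4 := le_self_pow₀ hY (by norm_num)
  have h2 : Y ^ 2 ≤ Y ^ 4 := Nat.pow_le_pow_right hY (by norm_num)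
  have h4 : 1 ≤ Y ^ 4 := Nat.one_le_pow _ _ hY
  have hWk := Nat.mul_le_mul hW hk
  have hkk := Nat.mul_le_mul hk hk
  nlinarith [hs, h1, h2, h4, hWk, hkk]

/-- `restartCost ≤ 222 Y⁵` (for the old assignment bounded by `Y²`). [folklore] -/
theorem restartCost_le {Y W S v : ℕ} (hY : 1 ≤ Y) (hk : k ≤ Y) (hd : dOf k ≤ Y) (hW : W ≤ Y) (hS : S + 1 ≤ Y)
    (hv : v ≤ Y ^ 2) : restartCost k W S v ≤ 222 * Y ^ 5 := by
  unfold restartCost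
  have hV : (S + 1) * W ≤ Y ^ 2 := by rw [pow_two]; exact Nat.mul_le_mul hS hW
  have hstep := stepCost_le hY hk hd hW hV
  have h1 : Y ≤ Y ^ 5 := le_self_pow₀ hY (by norm_num)
  have h2 : Y ^ 2 ≤ Y ^ 5 := Nat.pow_le_pow_right hY (by norm_num)
  have h5 : 1 ≤ Y ^ 5 := Nat.one_le_pow _ _ hY
  have hSstep : S * (stepCost k W ((S + 1) * W) + 2) ≤ Y * (172 * Y ^ 4 + 2) :=
    Nat.mul_le_mul (by omega) (by omega)
  have hkW : (2 * k + 12) * W ≤ (2 * Y + 12) * Y := Nat.mul_le_mul (by omega) hW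
  nlinarith [hstep, h1, h2, h5, hSstep, hkW]

/-- Elementary facts about the constant `cK`. [folklore] -/
theorem cK_facts (k : ℕ) : 60 ≤ cK k ∧ 2 * k + 1 ≤ cK k ∧ dOf k ≤ cK k ∧ 2 ^ dOf k + 1 ≤ cK k := by
  have h2d : 1 ≤ 2 ^ dOf k := Nat.one_le_two_pow
  have hdd : dOf k ≤ 2 ^ dOf k := (Nat.lt_two_pow_self).le
  unfold cK
  omega

/-- `progCost ≤ 227 Y⁵ |r| + 2 Y² + 15 Y + 22`. [folklore] -/
theorem progCost_le (φ : KCNF k) (rlen : ℕ) :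
    progCost k φ rlen ≤ 227 * Yb k φ.encodeBool.length ^ 5 * rlen + 2 * Yb k φ.encodeBool.length ^ 2 +
      15 * Yb k φ.encodeBool.length + 22 := by
  set L := φ.encodeBool.length
  set Y := Yb k L with hYdef
  obtain ⟨hc60, hc2k, hcd, -⟩ := cK_facts k
  have hYeq : Y = cK k * L + cK k * 2 := by rw [hYdef, Yb, Nat.mul_add]
  have hcL : 60 * L ≤ cK k * L := Nat.mul_le_mul_right L hc60
  have hY : 1 ≤ Y := by omega
  have hW : (formW φ).length ≤ Y := by have := length_formW_le φ; omega
  have hH : (encodeNat φ.numVars).length ≤ Y := by have := length_header_le φ; omega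
  have hkY : k ≤ Y := by omega
  have hdY : dOf k ≤ Y := by omega
  have hS : sOf φ + 1 ≤ Y := by
    unfold sOf
    have h1 := Nat.mul_le_mul_left (2 * k) (length_occs_le φ)
    have h2 := Nat.mul_le_mul_right L (show 2 * k ≤ cK k by omega)
    linarith
  have hV : (sOf φ + 1) * (formW φ).length ≤ Y ^ 2 := by rw [pow_two]; exact Nat.mul_le_mul hS hW
  have ht : ticketCost k (formW φ).length (sOf φ) ≤ 227 * Y ^ 5 := by
    unfold ticketCost
    have := restartCost_le hY hkY hdY hW hS hV
    have h5 : 1 ≤ Y ^ 5 := Nat.one_le_pow _ _ hY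
    omega
  unfold progCost
  have := Nat.mul_le_mul_right rlen ht
  have h2 : Y ≤ Y ^ 2 := by rw [pow_two]; exact Nat.le_mul_of_pos_left Y hY
  linarith [hV, hW, hH, this, h2]

/-- `L + 2 ≤ Y`. [folklore] -/
theorem length_add_two_le_Yb (k L : ℕ) : L + 2 ≤ Yb k L :=
  Nat.le_mul_of_pos_left _ (by have := (cK_facts k).1; omega)

/-- `|⟨encodeBool φ, r⟩| ≤ 2 Y + |r|`. [folklore] -/
theorem length_input_le (φ : KCNF k) (r : List Bool) :
    (boolPair φ.encodeBool r).length ≤ 2 * Yb k φ.encodeBool.length + r.length := by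
  rw [length_boolPair]
  have := length_add_two_le_Yb k φ.encodeBool.length
  omega

/-- **The machine time is within the time bound**: `machineTime ≤ 281 Y⁵ (|r| + 1)`. [folklore] -/
theorem machineTime_le (φ : KCNF k) (r : List Bool) :
    machineTime k φ r.length (boolPair φ.encodeBool r).length ≤ 281 * Yb k φ.encodeBool.length ^ 5 * (r.length + 1) := by
  unfold machineTime
  have h1 := progCost_le φ r.length
  have h2 := length_input_le (k := k) φ r
  set Y := Yb k φ.encodeBool.length
  have hY : 1 ≤ Y := by have := length_add_two_le_Yb k φ.encodeBool.length; omega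
  have h3 : Y ≤ Y ^ 5 := le_self_pow₀ hY (by norm_num)
  have h4 : Y ^ 2 ≤ Y ^ 5 := Nat.pow_le_pow_right hY (by norm_num)
  have h5 : 1 ≤ Y ^ 5 := Nat.one_le_pow _ _ hY
  have h6 : r.length ≤ Y ^ 5 * r.length := Nat.le_mul_of_pos_left _ (by omega)
  linarith [h1, h2, h3, h4, h5, h6]

/-- The coin budget is within the time bound. [folklore] -/
theorem mFun_le_TFun (k n L : ℕ) : mFun k n L ≤ TFun k n L := by
  unfold TFun
  have hY : 1 ≤ Yb k L := by have := length_add_two_le_Yb k L; omega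
  have h5 : 1 ≤ Yb k L ^ 5 := Nat.one_le_pow _ _ hY
  calc mFun k n L ≤ mFun k n L + 1 := Nat.le_succ _
    _ ≤ 281 * Yb k L ^ 5 * (mFun k n L + 1) := Nat.le_mul_of_pos_left _ (by omega)

/-! ### The time bound is `O(2^{δ n} poly(L))` -/

/-- The restart-count factor is at most `(2 - 2/k)^n + 1`. [folklore] -/
theorem qFactor_le (hk : 3 ≤ k) (n L : ℕ) :
    (((2 * k - 2) ^ min n L / k ^ min n L + 1 : ℕ) : ℝ) ≤ (2 - 2 / (k : ℝ)) ^ n + 1 := by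
  set t := min n L
  have hk0 : (0 : ℝ) < k := by exact_mod_cast (show 0 < k by omega)
  have hbase : ((2 * k - 2 : ℕ) : ℝ) / (k : ℝ) = 2 - 2 / (k : ℝ) := by
    rw [Nat.cast_sub (by omega)]; push_cast; field_simp
  have hge1 : (1 : ℝ) ≤ 2 - 2 / (k : ℝ) := by
    have : (2 : ℝ) / k ≤ 2 / 3 := by
      rw [div_le_div_iff₀ hk0 (by norm_num)]; have : (3 : ℝ) ≤ k := by exact_mod_cast hk
      linarith
    linarith
  have hq : (((2 * k - 2) ^ t / k ^ t : ℕ) : ℝ) ≤ (2 - 2 / (k : ℝ)) ^ n :=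
    calc (((2 * k - 2) ^ t / k ^ t : ℕ) : ℝ) ≤ (((2 * k - 2) ^ t : ℕ) : ℝ) / ((k ^ t : ℕ) : ℝ) := Nat.cast_div_le
      _ = (2 - 2 / (k : ℝ)) ^ t := by push_cast; rw [← div_pow, hbase]
      _ ≤ (2 - 2 / (k : ℝ)) ^ n := pow_le_pow_right₀ hge1 (min_le_left n L)
  push_cast
  linarith

/-- `(2 - 2/k)^n = 2^(log₂(2 - 2/k) · n)`. [folklore] -/
theorem base_pow_eq_rpow (hk : 3 ≤ k) (n : ℕ) :
    (2 - 2 / (k : ℝ)) ^ n = (2 : ℝ) ^ (Real.logb 2 (2 - 2 / (k : ℝ)) * n) := by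
  have hk0 : (0 : ℝ) < k := by exact_mod_cast (show 0 < k by omega)
  have hpos : (0 : ℝ) < 2 - 2 / (k : ℝ) := by
    have : (2 : ℝ) / k ≤ 2 / 3 := by
      rw [div_le_div_iff₀ hk0 (by norm_num)]; have : (3 : ℝ) ≤ k := by exact_mod_cast hk
      linarith
    linarith
  rw [Real.rpow_mul (by norm_num), Real.rpow_logb (by norm_num) (by norm_num) hpos, Real.rpow_natCast]

/-- The polynomial part of the time bound: `TFun ≤ 44960 (k-1)^(k-3) cK⁹ (L+1)⁹ · Q`. [folklore] -/
theorem TFun_le (hk : 3 ≤ k) (n L : ℕ) :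
    TFun k n L ≤ 44960 * ((k - 1) ^ (k - 3) * cK k ^ 9) * (L + 1) ^ 9 *
      ((2 * k - 2) ^ min n L / k ^ min n L + 1) := by
  obtain ⟨hc60, hc2k, hcd, hc2d⟩ := cK_facts k
  set Q := (2 * k - 2) ^ min n L / k ^ min n L + 1 with hQ
  set P := cK k * (L + 1) with hP
  set Kk := (k - 1) ^ (k - 3) with hKk
  have hL1 : 1 ≤ L + 1 := by omega
  have hP1 : 1 ≤ P := by have := Nat.mul_le_mul hc60 hL1; rw [← hP] at this; omega
  have hQ1 : 1 ≤ Q := by rw [hQ]; exact Nat.le_add_left 1 _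
  have hK1 : 1 ≤ Kk := Nat.one_le_pow _ _ (by omega)
  -- the factors of `RFun` and `cprMax` against `P`
  have hD1 : 2 ^ dOf k * (L + 1) + 1 ≤ P := by
    have := Nat.mul_le_mul_right (L + 1) hc2d; rw [Nat.add_mul, one_mul] at this; rw [hP]; omega
  have hD2 : k * (L + 1) + 1 ≤ P := by
    have := Nat.mul_le_mul_right (L + 1) (show k + 1 ≤ cK k by omega)
    rw [Nat.add_mul, one_mul] at this; rw [hP]; omega
  have hc1 : cprMax k L + 1 ≤ 2 * (P * P) := by
    unfold cprMax
    have h1 : 2 * k * (L + 1) + 1 ≤ P := by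
      have := Nat.mul_le_mul_right (L + 1) hc2k; rw [Nat.add_mul, one_mul] at this; rw [hP]; omega
    have h2 : dOf k ≤ P := hcd.trans (Nat.le_mul_of_pos_right _ (by omega))
    have h3 := Nat.mul_le_mul h1 h2
    have h4 : L + 1 + 1 ≤ P := by
      have := Nat.mul_le_mul_right (L + 1) hc60; rw [hP]; omega
    have h5 : P ≤ P * P := Nat.le_mul_of_pos_left _ (by omega)
    omega
  have hY : Yb k L ≤ 2 * P := by rw [hP]; unfold Yb; nlinarith
  -- `mFun + 1 ≤ 5 Kk P⁴ Q`
  have hm : mFun k n L + 1 ≤ 5 * Kk * P ^ 4 * Q := by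
    unfold mFun RFun
    rw [← hQ, ← hKk]
    have step : 2 * ((2 ^ dOf k * (L + 1) + 1) * (k * (L + 1) + 1) * Kk) * Q * (cprMax k L + 1) ≤
        2 * (P * P * Kk) * Q * (2 * (P * P)) := by gcongr
    have e : 2 * (P * P * Kk) * Q * (2 * (P * P)) = 4 * Kk * P ^ 4 * Q := by ring
    rw [e] at step
    have : 1 ≤ Kk * P ^ 4 * Q := by
      have := Nat.one_le_pow 4 P hP1
      calc 1 ≤ Kk := hK1
        _ ≤ Kk * P ^ 4 := Nat.le_mul_of_pos_right _ (by omega)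
        _ ≤ Kk * P ^ 4 * Q := Nat.le_mul_of_pos_right _ (by omega)
    nlinarith
  -- assemble
  unfold TFun
  calc 281 * Yb k L ^ 5 * (mFun k n L + 1) ≤ 281 * (2 * P) ^ 5 * (5 * Kk * P ^ 4 * Q) :=
        Nat.mul_le_mul (Nat.mul_le_mul_left _ (Nat.pow_le_pow_left hY 5)) hm
    _ = 44960 * (Kk * cK k ^ 9) * (L + 1) ^ 9 * Q := by rw [hP]; ring

/-- **The time bound is `O(2^{δ n} · poly(L))`** for `δ = log₂ (2 - 2/k)`. [folklore] -/
theorem isExpPolyBound_TFun (hk : 3 ≤ k) : IsExpPolyBound (Real.logb 2 (2 - 2 / (k : ℝ))) (TFun k) := by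
  obtain ⟨C₁, hC₁⟩ : ∃ C₁ : ℕ, C₁ = 44960 * ((k - 1) ^ (k - 3) * cK k ^ 9) := ⟨_, rfl⟩
  refine ⟨2 * C₁ + 9, fun n L => ?_⟩
  set δ := Real.logb 2 (2 - 2 / (k : ℝ)) with hδ
  obtain ⟨Q, hQ⟩ : ∃ Q : ℕ, Q = (2 * k - 2) ^ min n L / k ^ min n L + 1 := ⟨_, rfl⟩
  have hT : (TFun k n L : ℝ) ≤ (C₁ : ℝ) * ((L : ℝ) + 1) ^ 9 * Q := by
    have := TFun_le hk n L
    rw [← hQ, ← hC₁] at this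
    exact_mod_cast this
  have hQr : (Q : ℝ) ≤ 2 * (2 : ℝ) ^ (δ * n) := by
    have h1 := qFactor_le hk n L
    rw [← hQ, base_pow_eq_rpow hk n] at h1
    have h2n : (1 : ℝ) ≤ (2 : ℝ) ^ (δ * n) := by
      rw [← base_pow_eq_rpow hk n]
      refine one_le_pow₀ ?_
      have hk0 : (0 : ℝ) < k := by exact_mod_cast (show 0 < k by omega)
      have : (2 : ℝ) / k ≤ 2 / 3 := by
        rw [div_le_div_iff₀ hk0 (by norm_num)]; have : (3 : ℝ) ≤ k := by exact_mod_cast hk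
        linarith
      linarith
    linarith
  have hL1 : (1 : ℝ) ≤ (L : ℝ) + 1 := by have := (Nat.cast_nonneg L : (0 : ℝ) ≤ L); linarith
  have hpow9 : ((L : ℝ) + 1) ^ 9 ≤ ((L : ℝ) + 1) ^ (2 * C₁ + 9) := pow_le_pow_right₀ hL1 (Nat.le_add_left 9 _)
  have hC : (C₁ : ℝ) * 2 ≤ ((2 * C₁ + 9 : ℕ) : ℝ) := by push_cast; linarith
  have h0 : (0 : ℝ) ≤ (C₁ : ℝ) := Nat.cast_nonneg _
  calc (TFun k n L : ℝ) ≤ (C₁ : ℝ) * ((L : ℝ) + 1) ^ 9 * Q := hT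
    _ ≤ (C₁ : ℝ) * ((L : ℝ) + 1) ^ (2 * C₁ + 9) * (2 * (2 : ℝ) ^ (δ * n)) := by gcongr
    _ = ((C₁ : ℝ) * 2) * (2 : ℝ) ^ (δ * n) * ((L : ℝ) + 1) ^ (2 * C₁ + 9) := by ring
    _ ≤ ((2 * C₁ + 9 : ℕ) : ℝ) * (2 : ℝ) ^ (δ * n) * ((L : ℝ) + 1) ^ (2 * C₁ + 9) := by gcongr

end Literature.Computability.FineGrained.SchoeningCoin

/-! ### Discharge of `schoening` -/

namespace Literature.Computability.FineGrained

open _root_.Computability Complexity Turing SchoeningCoin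

/-- **fine-grained.S21, discharge of the named fact `schoening`: Schöning's theorem.** For every
`k ≥ 3`, `k`-SAT is in bounded-error randomized time `2^{δ n} · poly(L)` with
`δ = log₂ (2 - 2/k)`, i.e. `(2 - 2/k)^n · poly(L)` (Schöning, FOCS 1999, Theorem; textbook
statements: Schöning–Torán 2013, §5.4, Theorem — "there is a probabilistic algorithm for k-SAT
with running time `O*((2(1 - 1/k))^n)`" —, Hromkovič 2001, Thm 5.3.7.2 / Ex. 5.3.7.3). The
witness for `KSATInBPExpTime k δ`: the coin-string function `run φ (dOf k) (sOf φ) r` (the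
restart / random-walk algorithm reading its random bits from `r`, one-sided error —
`SchoeningCoinAlgorithm.lean`), the coin budget `mFun` (`R(n, L) ≥ 2/σ` complete restarts,
`R(n, L) = O((2 - 2/k)^n poly(L))`), the time bound `TFun` (`isExpPolyBound_TFun`), the machine
of `exists_machine` (`SchoeningCoinMachine.lean`, within `machineTime ≤ TFun`), and the success
probability `uniformProb_run_ge` (`SchoeningCoinBound.lean`) on satisfiable inputs,
`run = false = decide Satisfiable` surely on unsatisfiable ones.
[cite: SchoeningFOCS1999, Theorem] -/
theorem schoening_holds : schoening := by
  intro k hk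
  have hk1 : 1 ≤ k := by omega
  obtain ⟨M, hM⟩ := exists_machine (k := k) hk1
  refine ⟨fun φ r => run φ (dOf k) (sOf φ) r, fun n L => mFun k n L, TFun k, M, isExpPolyBound_TFun hk,
    fun n L => mFun_le_TFun k n L, fun φ r hr => ?_, fun φ => ?_⟩
  · -- the machine within the time bound
    refine (hM φ r).mono ?_
    refine (machineTime_le φ r).trans ?_
    unfold TFun
    rw [hr]
  · -- the success probability
    by_cases hφ : φ.Satisfiable
    · have hset : {r : List Bool | run φ (dOf k) (sOf φ) r = decide φ.Satisfiable} =
          {r | run φ (dOf k) (sOf φ) r = true} := by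
        ext r; simp [hφ]
      rw [hset]
      refine uniformProb_run_ge hφ hk (R := RFun k φ.numVars φ.encodeBool.length) ?_ (hR_of hk φ)
      unfold mFun
      exact Nat.mul_le_mul_left _ (Nat.succ_le_succ (cpr_le φ))
    · have hset : {r : List Bool | run φ (dOf k) (sOf φ) r = decide φ.Satisfiable} = Set.univ := by
        ext r; simp [hφ, run_eq_false_of_not_satisfiable hφ]
      rw [hset, uniformProb_univ]
      norm_num

end Literature.Computability.FineGrained
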